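import Summits.CriticalPhenomena.Ising3DConformalLimit.Theorems.PerfectScreeningGaussianLimitNotScreenedDefs
import Literature.Probability.LatticeModels.CurrentsPartialMonotonicity
import Literature.Probability.LatticeModels.IsingLaceThrough
import Literature.Probability.LatticeModels.IsingTransport
import HarnessLib

/-!
# Crux `GaussianLimitNotScreened` (stmt-CriticalPhenomena-13886, route PerfectScreening r4), line
# `karamata-amplitude-blind-merging`: registered stub `stub_depletionBound`
# (Aizenman–Duminil-Copin 2021, Lemma A.1 as an equality: the depletion bound in the free box)

In the free box `Λ_L ⊂ ℤ³` at `β_c(3)`, for `a, b, c, e ∈ Λ_L`, a class `good` of finite sets of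
sites and `0 ≤ c' ≤ 1`: if every `good` set `C ⊆ Λ_{L+1}` avoiding `c, e` depletes the transverse
two-point function, `⟨σ_cσ_e⟩_{Λ_L∖C} ≤ (1 − c')⟨σ_cσ_e⟩_{Λ_L}` (`defectG`, `boxG`), then
`c' · P^{ab,∅}_{Λ_L}[good(C(a))] ≤ P² = P^{ab,ce}_{Λ_L}[a ↔ c]` (`traceCluster`, `twoCurrentMeet`):
M. Aizenman, H. Duminil-Copin, Ann. of Math. **194** (2021) = arXiv:1912.07973, App. A, Lemma A.1
READ AS AN EQUALITY, `1 − P² = E^{ab,∅}[𝟙{c,e ∉ C}·⟨σ_cσ_e⟩_{Λ∖C}/⟨σ_cσ_e⟩_Λ]`, `C = C_{n₁+n₂}(a)`,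
then `⟨σ_cσ_e⟩_{Λ∖C} ≤ ⟨σ_cσ_e⟩_Λ` (Griffiths) off `good` and `≤ (1 − c')⟨σ_cσ_e⟩_Λ` on `good`.
§1 `depletion_core`: the un-normalised inequality on any finite graph (tree Lemma A.1
`Current.tsum_epairWeight_eq_tsum_mul_offRatio` with `F = 𝟙[c, e ∉ C_{n₁+n₂}(s)]`, which on
`{∂n₂ = {c}∆{e}}` is `𝟙[c ↮ s]`; termwise bounds; `M + D = Z[A]Z[ce]`). §2 dictionary in the free
box: `P^{A,B}[E] = (∑ w 𝟙_E)/(Z[A]Z[B])`; the restricted state of the tree (`Current.offRatio`,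
`offGraph`) IS the free model with a free defect (`IsingLace.isingTwoPoint_compl_eq_offGraph_univ`,
`isingCorr_free_eq_of_edgesIn_subset`, `isingTwoPoint_free_map`); the box cluster on the lifted
trace is `C_{n₁+n₂}(a)` (`liftBonds_mem_openConn_iff`); measurability of `good(C(a))`;
`G_L = Z[ce]/Z[∅]`. §3: the stub, dividing by `Z[ab]Z[∅]Z[ce] > 0` (`β_c(3) > 0`, `Λ_L` connected).
Everything is proved; nothing is defined or cited as a fact. [AizenmanDuminilCopinAnnals2021, App. A.1]
-/

noncomputable section

open Filter Topology Set Function MeasureTheory Finset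
open Literature.Probability.LatticeModels Literature.Probability.Percolation
open Summit.CriticalPhenomena.Ising3DConformalLimit.Cruxes.IsingEuclidUpgradeR4NonGaussian.FreeCovarianceDeltaDichotomy
  (boxG twoCurrentMeet)
open scoped symmDiff ENNReal

namespace Summit.CriticalPhenomena.Ising3DConformalLimit.Cruxes.GaussianLimitNotScreened.KaramataAmplitudeBlindMerging

section FiniteGraph

variable {V : Type*} [Fintype V] [DecidableEq V] {G : SimpleGraph V} [DecidableRel G.Adj]
  {K : G.edgeFinset → ℝ}

open Current

/-- **§1. The depletion bound, un-normalised** (ADC21 Lemma A.1 as an equality; `S = {s}`,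
`B = {c}∆{e}`, `F = 𝟙[c, e ∉ C_{n₁+n₂}(s)]`). For `K ≥ 0`, a source set `A`, a class `good`,
`θ + κ ≤ 1` and a weight `ind ≤ 𝟙[good(C(s))]`: if every `good` `T` avoiding `c, e` has
`(Z_{G∖T}[ce]/Z_{G∖T}[∅]) Z[∅] ≤ θ Z[ce]`, then `κ (∑_{A,∅} w w ind) Z[ce] ≤ (∑_{A,ce} w w 𝟙[c ∈ C(s)]) Z[∅]`.
Proof: Lemma A.1 (`Current.tsum_epairWeight_eq_tsum_mul_offRatio`) turns the disconnection mass
`D = ∑_{A,ce} w w 𝟙[c ↮ s]` (`n₂` joins `c` to `e`, so `F = 𝟙[c ↮ s]` there) into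
`∑_{A,∅} w w F · Z_{G∖C}[ce]/Z_{G∖C}[∅]`; bound termwise (`θ` on `good`, Griffiths
`Current.offRatio_pair_mul_le` off `good`) and cancel `D Z[∅]` in `M + D = Z[A]Z[ce]`.
[cite: AizenmanDuminilCopinAnnals2021, arXiv:1912.07973 Appendix A.1, Lemma A.1; eq. (3.11)] -/
theorem depletion_core (hK : ∀ e, 0 ≤ K e) (s c e : V) (A : Finset V)
    (good : Finset V → Prop) {θ κ : ℝ≥0∞} (hθκ : θ + κ ≤ 1)
    (hgood : ∀ T : Finset V, good T → c ∉ T → e ∉ T →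
      offRatio K T ({c} ∆ {e}) * ecurrentSum K ∅ ≤ θ * ecurrentSum K ({c} ∆ {e}))
    (ind : Current G × Current G → ℝ≥0∞) (hind1 : ∀ p, ind p ≤ 1)
    (hind : ∀ p, ind p ≠ 0 → good ((p.1 + p.2).cluster s)) :
    κ * (∑' p : Current G × Current G, epairWeight K A ∅ p * ind p) * ecurrentSum K ({c} ∆ {e}) ≤
      (∑' p : Current G × Current G, epairWeight K A ({c} ∆ {e}) p * connInd c s p) *
        ecurrentSum K ∅ := by
  classical
  obtain ⟨F, hF⟩ : ∃ F : Current G × Current G → ℝ≥0∞, ∀ p,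
      F p = if c ∉ (p.1 + p.2).cluster s ∧ e ∉ (p.1 + p.2).cluster s then 1 else 0 :=
    ⟨_, fun _ => rfl⟩
  -- Lemma A.1 for `F`: locality in `n₂` and vanishing
  have hloc : ∀ n₁ n₂ n₂' : Current G,
      (∀ e' : G.edgeFinset, ¬ EdgeOff ((n₁ + n₂).cluster s) (e' : Sym2 V) → n₂' e' = n₂ e') →
      F (n₁, n₂') = F (n₁, n₂) := fun n₁ n₂ n₂' h => by
    simp only [hF, cluster_add_congr_right h]
  have hvan : ∀ n₁ n₂ : Current G, n₁.sources = A → n₂.sources = {c} ∆ {e} → F (n₁, n₂) ≠ 0 →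
      Disjoint ((n₁ + n₂).cluster s) ({c} ∆ {e}) := by
    intro n₁ n₂ _ _ hF0
    have h' : c ∉ (n₁ + n₂).cluster s ∧ e ∉ (n₁ + n₂).cluster s := by
      by_contra h'
      exact hF0 (by rw [hF]; exact if_neg h')
    exact Finset.disjoint_right.2 fun v hv hvC =>
      (eq_or_eq_of_mem_symmDiff_singleton hv).elim (fun h => h'.1 (h ▸ hvC)) fun h => h'.2 (h ▸ hvC)
  -- on `{∂n₂ = {c}∆{e}}` the functional `F` is `𝟙[c ↮ s]`, so the left side of Lemma A.1 is `D`
  have hD : ∑' p, epairWeight K A ({c} ∆ {e}) p * disconnInd c s p = ∑' p : Current G × Current G,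
      epairWeight K A ∅ p * (F p * offRatio K ((p.1 + p.2).cluster s) ({c} ∆ {e})) := by
    rw [← tsum_epairWeight_eq_tsum_mul_offRatio hK s A ({c} ∆ {e}) F hloc hvan]
    refine tsum_congr fun p => ?_
    by_cases hs2 : p.2.sources = {c} ∆ {e}
    · have hec : e ∈ (p.1 + p.2).cluster c := mem_cluster_add_of_sources_eq_right p.1 hs2
      rw [hF]
      unfold disconnInd
      by_cases hcC : c ∈ (p.1 + p.2).cluster s
      · rw [if_pos hcC, if_neg fun h => h.1 hcC]
      · rw [if_neg hcC,
          if_pos ⟨hcC, fun heC => hcC (mem_cluster_trans heC (mem_cluster_comm.1 hec))⟩]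
    · unfold epairWeight
      rw [if_neg fun h => hs2 h.2, zero_mul, zero_mul]
  -- termwise: `F · offRatio · Z[∅] + κ ind Z[ce] ≤ Z[ce]`
  have hpt : ∀ p : Current G × Current G,
      F p * offRatio K ((p.1 + p.2).cluster s) ({c} ∆ {e}) * ecurrentSum K ∅ +
        κ * ind p * ecurrentSum K ({c} ∆ {e}) ≤ ecurrentSum K ({c} ∆ {e}) := by
    intro p
    by_cases hgp : good ((p.1 + p.2).cluster s)
    · have h1 : F p * offRatio K ((p.1 + p.2).cluster s) ({c} ∆ {e}) * ecurrentSum K ∅ ≤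
          θ * ecurrentSum K ({c} ∆ {e}) := by
        rw [hF]
        by_cases hce : c ∉ (p.1 + p.2).cluster s ∧ e ∉ (p.1 + p.2).cluster s
        · rw [if_pos hce, one_mul]
          exact hgood _ hgp hce.1 hce.2
        · rw [if_neg hce, zero_mul, zero_mul]
          exact bot_le
      calc _ ≤ θ * ecurrentSum K ({c} ∆ {e}) + κ * 1 * ecurrentSum K ({c} ∆ {e}) :=
            add_le_add h1 (mul_le_mul' (mul_le_mul' le_rfl (hind1 p)) le_rfl)
        _ = (θ + κ) * ecurrentSum K ({c} ∆ {e}) := by ring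
        _ ≤ 1 * ecurrentSum K ({c} ∆ {e}) := mul_le_mul' hθκ le_rfl
        _ = _ := one_mul _
    · have h0 : ind p = 0 := by
        by_contra h0
        exact hgp (hind p h0)
      have h1 : F p ≤ 1 := by rw [hF]; split_ifs <;> simp
      rw [h0, mul_zero, zero_mul, add_zero]
      exact (mul_le_mul' (mul_le_mul' h1 le_rfl) le_rfl).trans
        (by rw [one_mul]; exact offRatio_pair_mul_le hK _ c e)
  -- sum: `D Z[∅] + κ Q Z[ce] ≤ Z[A] Z[∅] Z[ce] = (M + D) Z[∅]`, then cancel `D Z[∅] < ∞`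
  have hsum : (∑' p, epairWeight K A ({c} ∆ {e}) p * disconnInd c s p) * ecurrentSum K ∅ +
      κ * (∑' p, epairWeight K A ∅ p * ind p) * ecurrentSum K ({c} ∆ {e}) ≤
      ecurrentSum K A * ecurrentSum K ∅ * ecurrentSum K ({c} ∆ {e}) := by
    rw [hD, ← tsum_epairWeight K A ∅, ← ENNReal.tsum_mul_right, ← ENNReal.tsum_mul_right,
      mul_assoc κ, ← ENNReal.tsum_mul_right, ← ENNReal.tsum_mul_left, ← ENNReal.tsum_add]
    refine ENNReal.tsum_le_tsum fun p => ?_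
    calc epairWeight K A ∅ p * (F p * offRatio K ((p.1 + p.2).cluster s) ({c} ∆ {e})) *
          ecurrentSum K ∅ + κ * (epairWeight K A ∅ p * ind p * ecurrentSum K ({c} ∆ {e}))
        = epairWeight K A ∅ p * (F p * offRatio K ((p.1 + p.2).cluster s) ({c} ∆ {e}) *
            ecurrentSum K ∅ + κ * ind p * ecurrentSum K ({c} ∆ {e})) := by ring
      _ ≤ epairWeight K A ∅ p * ecurrentSum K ({c} ∆ {e}) := mul_le_mul' le_rfl (hpt p)
  have hDfin : (∑' p, epairWeight K A ({c} ∆ {e}) p * disconnInd c s p) * ecurrentSum K ∅ ≠ ∞ :=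
    ENNReal.mul_ne_top (ne_top_of_le_ne_top
      (ENNReal.mul_ne_top (ecurrentSum_ne_top hK _) (ecurrentSum_ne_top hK _))
      (tsum_epairWeight_mul_le A _ fun p => by unfold disconnInd; split_ifs <;> simp))
      (ecurrentSum_ne_top hK _)
  refine (ENNReal.add_le_add_iff_left hDfin).1 (hsum.trans_eq ?_)
  rw [mul_right_comm, ← tsum_connInd_add_tsum_disconnInd (K := K) A ({c} ∆ {e}) c s]
  ring

-- adapted from `EnergyNotSigmaSquaredGapForcesFarMergingScreeningIdentity` (crux 4468)
/-- **§2a.** The double-current measure of an event as an `ℝ≥0∞` series,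
`P^{A,B}[E] = (∑_p 1{∂n₁=A}1{∂n₂=B} w w 𝟙_E)/(Z[A]Z[B])`, for the constant coupling `K ≡ β ≥ 0` and
nondegenerate normalisers. [cite: AizenmanDuminilCopinAnnals2021, §3.1] -/
theorem dcm_apply_eq_tsum_div (G : SimpleGraph V) [DecidableRel G.Adj] {β : ℝ}
    (K : G.edgeFinset → ℝ) (hKβ : K = fun _ => β) (hβ : 0 ≤ β) {A B : Finset V}
    (hA : currentSum G β A ≠ 0) (hB : currentSum G β B ≠ 0) (E : Set (Current G × Current G)) :
    doubleCurrentMeasure G β A B E =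
      (∑' p, epairWeight K A B p * E.indicator 1 p) / (ecurrentSum K A * ecurrentSum K B) := by
  subst hKβ
  have hE : MeasurableSet E := E.to_countable.measurableSet
  have hZ : 0 < currentSum G β A * currentSum G β B :=
    mul_pos (lt_of_le_of_ne (currentSum_nonneg G hβ A) (Ne.symm hA))
      (lt_of_le_of_ne (currentSum_nonneg G hβ B) (Ne.symm hB))
  have hw : ∀ p, ENNReal.ofReal (pairWeight G β A B p) =
      epairWeight (fun _ : G.edgeFinset => β) A B p := fun p => by
    unfold pairWeight epairWeight Current.eweight
    split_ifs with h
    · rw [ENNReal.ofReal_mul (Current.weight_nonneg hβ _)]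
      rfl
    · exact ENNReal.ofReal_zero
  rw [doubleCurrentMeasure, Measure.sum_apply _ hE, div_eq_mul_inv, ← ENNReal.tsum_mul_right]
  refine tsum_congr fun p => ?_
  rw [Measure.smul_apply, smul_eq_mul, Measure.dirac_apply' _ hE, ENNReal.ofReal_div_of_pos hZ,
    ENNReal.ofReal_mul (currentSum_nonneg G hβ A), hw, currentSum_eq_wcurrentSum,
    currentSum_eq_wcurrentSum, ← ecurrentSum_eq_ofReal (fun _ => hβ),
    ← ecurrentSum_eq_ofReal (fun _ => hβ), div_eq_mul_inv]
  ring

-- adapted from `IsingLace.zOff_eq_toReal_ecurrentSumIn`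
/-- The real part of the supported `ℝ≥0∞` current sum of `offGraph G T` (constant coupling `β ≥ 0`)
is the tree's real current sum of the graph `offGraph G T` (Sakai's (2.4)). [cite: Sakai2007, (2.4)] -/
theorem toReal_ecurrentSumIn_offGraph (G : SimpleGraph V) [DecidableRel G.Adj] {β : ℝ}
    (K : G.edgeFinset → ℝ) (hKβ : K = fun _ => β) (hβ : 0 ≤ β) (T B : Finset V) :
    (ecurrentSumIn (offGraph G T) K B).toReal = currentSum (offGraph G T) β B := by
  subst hKβ
  rw [IsingLace.currentSum_offGraph]
  unfold ecurrentSumIn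
  rw [ENNReal.tsum_toReal_eq fun n => by split_ifs <;> simp]
  refine tsum_congr fun n => ?_
  split_ifs
  · rw [Current.eweight, ← Current.weight_eq_wweight,
      ENNReal.toReal_ofReal (Current.weight_nonneg hβ n)]
  · rfl

end FiniteGraph

/-- **§2b. The restricted state of the tree is the free model with a free defect**: for box vertices
`c, e ∈ Λ_L` outside `T`, `(Z_{G∖T}[ce]/Z_{G∖T}[∅]).toReal = ⟨σ_cσ_e⟩_{Λ_L ∖ T, β_c}` (`defectG`):
`G ∖ T` carries the free model on `Tᶜ` (`IsingLace.isingTwoPoint_compl_eq_offGraph_univ`), whose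
two-point function inside `Λ_L ∖ T` is that of the volume `Λ_L ∖ T` (no edge of the free box graph
leaves `Λ_L`, `isingCorr_free_eq_of_edgesIn_subset`), transported along `↥Λ_{L+1} ↪ ℤ³`
(`isingTwoPoint_free_map`). [cite: AizenmanDuminilCopinAnnals2021, arXiv:1912.07973 Appendix A.1, Lemma A.1 (restricted state)] -/
theorem toReal_offRatio_eq_defectG (L : ℕ) (K : (freeBoxGraph 3 L).edgeFinset → ℝ)
    (hKβ : K = fun _ => criticalBeta 3) (T : Finset (BoxVertex 3 L)) (c₀ e₀ : BoxVertex 3 L)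
    (hc : (c₀ : Site 3) ∈ box 3 L) (he : (e₀ : Site 3) ∈ box 3 L) (hcT : c₀ ∉ T) (heT : e₀ ∉ T) :
    (Current.offRatio K T ({c₀} ∆ {e₀})).toReal = defectG L (T.map (boxEmb 3 L)) c₀ e₀ := by
  have hβ : 0 ≤ criticalBeta 3 := criticalBeta_nonneg 3
  rw [Current.offRatio, ENNReal.toReal_div, toReal_ecurrentSumIn_offGraph _ K hKβ hβ,
    toReal_ecurrentSumIn_offGraph _ K hKβ hβ,
    ← isingTwoPoint_free_eq_currentSum_div_holds (offGraph (freeBoxGraph 3 L) T) (criticalBeta 3)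
      c₀ e₀,
    ← IsingLace.isingTwoPoint_compl_eq_offGraph_univ (G := freeBoxGraph 3 L) (criticalBeta 3)
      hcT heT]
  have hadj : ∀ x ∈ boxCore 3 L \ T, ∀ y ∈ boxCore 3 L \ T,
      ((zdGraph 3).Adj (boxEmb 3 L x) (boxEmb 3 L y) ↔ (freeBoxGraph 3 L).Adj x y) := by
    intro x hx y hy
    rw [freeBoxGraph_adj, boxEmb_apply, boxEmb_apply]
    exact ⟨fun h => ⟨h, (mem_boxCore 3).1 (Finset.mem_sdiff.1 hx).1,
      (mem_boxCore 3).1 (Finset.mem_sdiff.1 hy).1⟩, fun h => h.1⟩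
  have key := isingTwoPoint_free_map (boxEmb 3 L) hadj (criticalBeta 3) 0 c₀ e₀
  rw [Finset.map_sdiff, map_boxCore, boxEmb_apply, boxEmb_apply] at key
  rw [defectG, key, isingTwoPoint_eq_isingCorr_symmDiff, isingTwoPoint_eq_isingCorr_symmDiff]
  have h12 : boxCore 3 L \ T ⊆ Tᶜ := fun x hx => Finset.mem_compl.2 (Finset.mem_sdiff.1 hx).2
  have hE : edgesIn (freeBoxGraph 3 L) Tᶜ ⊆ edgesIn (freeBoxGraph 3 L) (boxCore 3 L \ T) := by
    intro d hd
    rw [mem_edgesIn_iff] at hd ⊢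
    have hin : d ∈ edgesIn (freeBoxGraph 3 L) (boxCore 3 L) := by
      rw [edgesIn_freeBoxGraph, edgesTouching_freeBoxGraph, SimpleGraph.mem_edgeFinset]
      exact hd.1
    exact ⟨hd.1, fun x hx => Finset.mem_sdiff.2
      ⟨(mem_edgesIn_iff.1 hin).2 x hx, Finset.mem_compl.1 (hd.2 x hx)⟩⟩
  have hA : ({c₀} : Finset (BoxVertex 3 L)) ∆ {e₀} ⊆ boxCore 3 L \ T := by
    intro x hx
    rcases Current.eq_or_eq_of_mem_symmDiff_singleton hx with rfl | rfl
    · exact Finset.mem_sdiff.2 ⟨(mem_boxCore 3).2 hc, hcT⟩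
    · exact Finset.mem_sdiff.2 ⟨(mem_boxCore 3).2 he, heT⟩
  exact isingCorr_free_eq_of_edgesIn_subset (freeBoxGraph 3 L) h12 hE (criticalBeta 3) 0 hA

-- adapted from `IsingEuclidUpgradeR4NonGaussianSecondMomentBox` (private `boxG_eq_div` there)
/-- `G_L(x,y) = Z[{x}∆{y}]/Z[∅]` on the free box graph (random-current representation). [folklore] -/
theorem boxG_eq_toReal_div (L : ℕ) (K : (freeBoxGraph 3 L).edgeFinset → ℝ)
    (hKβ : K = fun _ => criticalBeta 3) (x y : BoxVertex 3 L) (hx : (x : Site 3) ∈ box 3 L)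
    (hy : (y : Site 3) ∈ box 3 L) :
    boxG L x y = (ecurrentSum K ({x} ∆ {y})).toReal / (ecurrentSum K ∅).toReal := by
  subst hKβ
  have hK : ∀ e : (freeBoxGraph 3 L).edgeFinset,
      0 ≤ (fun _ : (freeBoxGraph 3 L).edgeFinset => criticalBeta 3) e := fun _ => criticalBeta_nonneg 3
  rw [boxG, isingTwoPoint_free_box_eq_boxGraph 3 L _ x y hx hy,
    isingTwoPoint_free_eq_currentSum_div_holds (freeBoxGraph 3 L) (criticalBeta 3) x y,
    currentSum_eq_wcurrentSum, currentSum_eq_wcurrentSum, toReal_ecurrentSum hK, toReal_ecurrentSum hK]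

/-- **The box cluster read on the lifted trace**: for a box vertex `a`, the cluster
`traceCluster L (sourcedTrace 3 L p) a ⊆ Λ_{L+1}` of the lifted trace of `n₁ + n₂` is the image in
`ℤ³` of the tree's cluster `C_{n₁+n₂}(a)` (`liftBonds_mem_openConn_iff`). [cite: AizenmanDuminilCopinAnnals2021, §3.2] -/
theorem traceCluster_sourcedTrace (L : ℕ)
    (p : Current (freeBoxGraph 3 L) × Current (freeBoxGraph 3 L)) (a₀ : BoxVertex 3 L) :
    traceCluster L (sourcedTrace 3 L p) a₀ = ((p.1 + p.2).cluster a₀).map (boxEmb 3 L) := by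
  ext v
  simp only [traceCluster, Finset.mem_filter, Finset.mem_map, boxEmb_apply]
  constructor
  · rintro ⟨hv, hconn⟩
    exact ⟨⟨v, hv⟩, Current.mem_cluster_iff.2
      ((liftBonds_mem_openConn_iff 3 _ a₀ ⟨v, hv⟩).1 hconn), rfl⟩
  · rintro ⟨w, hw, rfl⟩
    exact ⟨w.2, (liftBonds_mem_openConn_iff 3 _ a₀ w).2 (Current.mem_cluster_iff.1 hw)⟩

/-- The event `{ω | good (C(a) ∩ Λ_{L+1})}` is measurable: `ω ↦ traceCluster L ω a` is measurable
into the countable discrete space of finite sets (each membership `v ∈ C(a)` is the measurable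
connection event `{a ↔ v}`, `measurableSet_openConn_holds`). [folklore] -/
theorem measurableSet_good_traceCluster (L : ℕ) (good : Finset (Site 3) → Prop) (a : Site 3) :
    MeasurableSet {ω : BondConfig (Site 3) | good (traceCluster L ω a)} := by
  have hmeas : Measurable fun ω : BondConfig (Site 3) => traceCluster L ω a := by
    rw [measurable_finset_iff]
    intro v
    refine measurableSet_setOf.1 ?_
    have hset : {ω : BondConfig (Site 3) | v ∈ traceCluster L ω a} =
        {_ω : BondConfig (Site 3) | v ∈ box 3 (L + 1)} ∩ openConn a v := by
      ext ω
      simp only [traceCluster, Finset.mem_filter, Set.mem_setOf_eq, Set.mem_inter_iff]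
    rw [hset]
    exact (MeasurableSet.const _).inter (measurableSet_openConn_holds _ _)
  exact hmeas (Set.to_countable {T : Finset (Site 3) | good T}).measurableSet

/-- **§3. Registered stub `stub_depletionBound` — THE DEPLETION BOUND** (line
`karamata-amplitude-blind-merging` of crux stmt-CriticalPhenomena-13886; ADC21 Lemma A.1 read as an
equality, free box `Λ_L ⊂ ℤ³` at `β_c(3)`): for `a, b, c, e ∈ Λ_L`, a class `good` and `0 ≤ c' ≤ 1`,
if every `good` `C ⊆ Λ_{L+1}` avoiding `c, e` has `⟨σ_cσ_e⟩_{Λ_L∖C} ≤ (1 − c')⟨σ_cσ_e⟩_{Λ_L}`, then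
`c' · P^{ab,∅}_{Λ_L}[good(C(a))] ≤ P^{ab,ce}_{Λ_L}[a ↔ c]`. Proof: `depletion_core` through the
dictionary of §2, then division by `Z[ab]Z[∅]Z[ce] > 0`; degenerate cases (`a = b`, `c = e`,
`c ∈ {a,b}`) are instances of the same identity.
[cite: AizenmanDuminilCopinAnnals2021, arXiv:1912.07973 Appendix A.1, Lemma A.1; eq. (3.11)] -/
theorem stub_depletionBound :
    ∀ (L : ℕ) (a b c e : Site 3), a ∈ box 3 L → b ∈ box 3 L → c ∈ box 3 L → e ∈ box 3 L →
      ∀ (good : Finset (Site 3) → Prop) (c' : ℝ), 0 ≤ c' → c' ≤ 1 →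
      (∀ C : Finset (Site 3), good C → c ∉ C → e ∉ C → C ⊆ box 3 (L + 1) →
          defectG L C c e ≤ (1 - c') * boxG L c e) →
      c' * (sourcedDoubleCurrentLaw 3 L (criticalBeta 3) ({a} ∆ {b}) ∅).real
          {ω | good (traceCluster L ω a)} ≤ twoCurrentMeet L a b c e := by
  intro L a b c e ha hb hc he good c' hc'0 hc'1 hdep
  classical
  -- box vertices and the constant coupling `K ≡ β_c(3)` (kept opaque)
  have hl : ∀ x ∈ box 3 L, ∃ x' : BoxVertex 3 L, (x' : Site 3) = x := fun x hx =>
    ⟨⟨x, box_subset_box_succ 3 L hx⟩, rfl⟩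
  obtain ⟨⟨a₀, rfl⟩, ⟨b₀, rfl⟩, ⟨c₀, rfl⟩, ⟨e₀, rfl⟩⟩ :=
    And.intro (hl a ha) (And.intro (hl b hb) (And.intro (hl c hc) (hl e he)))
  obtain ⟨K, hKβ⟩ : ∃ K : (freeBoxGraph 3 L).edgeFinset → ℝ, K = fun _ => criticalBeta 3 :=
    ⟨_, rfl⟩
  have hβ : 0 ≤ criticalBeta 3 := criticalBeta_nonneg 3
  have hK : ∀ e', 0 ≤ K e' := fun _ => by rw [hKβ]; exact hβ
  have hZtop : ∀ S, ecurrentSum K S ≠ ∞ := fun S => ecurrentSum_ne_top hK S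
  -- the partition functions do not vanish (`β_c(3) > 0`, `Λ_L` is connected in the free box graph)
  have hcs : ∀ x y : BoxVertex 3 L, (x : Site 3) ∈ box 3 L → (y : Site 3) ∈ box 3 L →
      currentSum (freeBoxGraph 3 L) (criticalBeta 3) ({x} ∆ {y}) ≠ 0 := fun x y hx hy => by
    obtain ⟨w⟩ := freeBoxGraph_reachable 3 hx hy
    exact (currentSum_pos_of_exists _ (criticalBeta_pos_holds (d := 3) (by norm_num))
      (exists_current_sources_eq_of_walk _ w)).ne'
  have hcs0 : currentSum (freeBoxGraph 3 L) (criticalBeta 3) ∅ ≠ 0 :=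
    (currentSum_empty_pos' _ _).ne'
  have hZ_of : ∀ S, currentSum (freeBoxGraph 3 L) (criticalBeta 3) S ≠ 0 → ecurrentSum K S ≠ 0 :=
    fun S hS h0 => hS (by
      rw [currentSum_eq_wcurrentSum, ← hKβ, ← toReal_ecurrentSum hK, h0, ENNReal.toReal_zero])
  have hz0 : 0 < (ecurrentSum K ∅).toReal := ENNReal.toReal_pos (hZ_of _ hcs0) (hZtop _)
  have hzA : 0 < (ecurrentSum K ({a₀} ∆ {b₀})).toReal :=
    ENNReal.toReal_pos (hZ_of _ (hcs a₀ b₀ ha hb)) (hZtop _)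
  have hzB : 0 < (ecurrentSum K ({c₀} ∆ {e₀})).toReal :=
    ENNReal.toReal_pos (hZ_of _ (hcs c₀ e₀ hc he)) (hZtop _)
  -- §1 in the box: the depletion hypothesis through the dictionary of §2
  have hθκ : ENNReal.ofReal (1 - c') + ENNReal.ofReal c' ≤ 1 := by
    rw [← ENNReal.ofReal_add (by linarith) hc'0, sub_add_cancel, ENNReal.ofReal_one]
  have hgood : ∀ T : Finset (BoxVertex 3 L), good (T.map (boxEmb 3 L)) → c₀ ∉ T → e₀ ∉ T →
      Current.offRatio K T ({c₀} ∆ {e₀}) * ecurrentSum K ∅ ≤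
        ENNReal.ofReal (1 - c') * ecurrentSum K ({c₀} ∆ {e₀}) := by
    intro T hT hcT heT
    have h1 := hdep (T.map (boxEmb 3 L)) hT (fun h => hcT ((Finset.mem_map' _).1 h))
      (fun h => heT ((Finset.mem_map' _).1 h)) fun x hx => by
        obtain ⟨y, -, rfl⟩ := Finset.mem_map.1 hx
        exact y.2
    rw [← toReal_offRatio_eq_defectG L K hKβ T c₀ e₀ hc he hcT heT,
      boxG_eq_toReal_div L K hKβ c₀ e₀ hc he, ← mul_div_assoc, le_div_iff₀ hz0] at h1
    have hoff : Current.offRatio K T ({c₀} ∆ {e₀}) ≠ ∞ := ENNReal.div_ne_top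
      (ecurrentSumIn_ne_top _ hK _) (lt_of_lt_of_le zero_lt_one (one_le_ecurrentSumIn_empty _ K)).ne'
    rw [← ENNReal.toReal_le_toReal (ENNReal.mul_ne_top hoff (hZtop _))
      (ENNReal.mul_ne_top ENNReal.ofReal_ne_top (hZtop _)), ENNReal.toReal_mul, ENNReal.toReal_mul,
      ENNReal.toReal_ofReal (by linarith)]
    exact h1
  -- the `good` event read on pairs of currents, and the core inequality
  obtain ⟨S, hS⟩ : ∃ S : Set (Current (freeBoxGraph 3 L) × Current (freeBoxGraph 3 L)),
      S = {q | good (((q.1 + q.2).cluster a₀).map (boxEmb 3 L))} := ⟨_, rfl⟩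
  have hcore := depletion_core hK a₀ c₀ e₀ ({a₀} ∆ {b₀}) (fun T => good (T.map (boxEmb 3 L)))
    hθκ hgood (S.indicator 1) (fun p => by unfold Set.indicator; split_ifs <;> simp)
    (fun p hp => by
      have hpS : p ∈ S := by
        by_contra hpS
        exact hp (Set.indicator_of_notMem hpS _)
      rw [hS] at hpS
      exact hpS)
  -- §2 in the box: the two probabilities as ratios of current sums
  have hP1 : sourcedDoubleCurrentLaw 3 L (criticalBeta 3) ({(a₀ : Site 3)} ∆ {(b₀ : Site 3)}) ∅
      {ω | good (traceCluster L ω (a₀ : Site 3))} =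
      (∑' p : Current (freeBoxGraph 3 L) × Current (freeBoxGraph 3 L),
        epairWeight K ({a₀} ∆ {b₀}) ∅ p * S.indicator 1 p) /
        (ecurrentSum K ({a₀} ∆ {b₀}) * ecurrentSum K ∅) := by
    rw [sourcedDoubleCurrentLaw_apply L (criticalBeta 3) _ _
        (measurableSet_good_traceCluster L good a₀), boxSources_pair, boxSources_empty,
      dcm_apply_eq_tsum_div _ K hKβ hβ (hcs a₀ b₀ ha hb) hcs0]
    congr 1
    refine tsum_congr fun p => ?_
    congr 1
    simp only [hS, Set.indicator_apply, Set.mem_preimage, Set.mem_setOf_eq,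
      traceCluster_sourcedTrace]
  have hP2 : sourcedDoubleCurrentLaw 3 L (criticalBeta 3) ({(a₀ : Site 3)} ∆ {(b₀ : Site 3)})
      ({(c₀ : Site 3)} ∆ {(e₀ : Site 3)}) (openConn (a₀ : Site 3) (c₀ : Site 3)) =
      (∑' p : Current (freeBoxGraph 3 L) × Current (freeBoxGraph 3 L),
        epairWeight K ({a₀} ∆ {b₀}) ({c₀} ∆ {e₀}) p * Current.connInd c₀ a₀ p) /
        (ecurrentSum K ({a₀} ∆ {b₀}) * ecurrentSum K ({c₀} ∆ {e₀})) := by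
    rw [sourcedDoubleCurrentLaw_apply L (criticalBeta 3) _ _ (measurableSet_openConn_holds _ _),
      boxSources_pair, boxSources_pair, sourcedTrace_preimage_openConn,
      dcm_apply_eq_tsum_div _ K hKβ hβ (hcs a₀ b₀ ha hb) (hcs c₀ e₀ hc he)]
    congr 1
    refine tsum_congr fun p => ?_
    congr 1
    unfold Current.connInd
    by_cases h : c₀ ∈ (p.1 + p.2).cluster a₀
    · rw [if_pos h, Set.indicator_of_mem
        (show p ∈ tracedConn (freeBoxGraph 3 L) a₀ c₀ from Current.mem_cluster_iff.1 h),
        Pi.one_apply]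
    · rw [if_neg h, Set.indicator_of_notMem]
      exact fun h' => h (Current.mem_cluster_iff.2 h')
  -- §3: finiteness of the connection mass, and division by `Z[ab] Z[∅] Z[ce] > 0`
  have hMtop : (∑' p : Current (freeBoxGraph 3 L) × Current (freeBoxGraph 3 L),
      epairWeight K ({a₀} ∆ {b₀}) ({c₀} ∆ {e₀}) p * Current.connInd c₀ a₀ p) ≠ ∞ :=
    ne_top_of_le_ne_top (ENNReal.mul_ne_top (hZtop _) (hZtop _))
      (Current.tsum_epairWeight_mul_le _ _ fun p => by
        unfold Current.connInd; split_ifs <;> simp)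
  have hreal := ENNReal.toReal_mono (ENNReal.mul_ne_top hMtop (hZtop _)) hcore
  rw [ENNReal.toReal_mul, ENNReal.toReal_mul, ENNReal.toReal_mul, ENNReal.toReal_ofReal hc'0]
    at hreal
  rw [twoCurrentMeet, measureReal_def, measureReal_def, hP1, hP2, ENNReal.toReal_div,
    ENNReal.toReal_div, ENNReal.toReal_mul, ENNReal.toReal_mul, ← mul_div_assoc,
    div_le_div_iff₀ (mul_pos hzA hz0) (mul_pos hzA hzB)]
  nlinarith [mul_le_mul_of_nonneg_right hreal hzA.le]

end Summit.CriticalPhenomena.Ising3DConformalLimit.Cruxes.GaussianLimitNotScreened.KaramataAmplitudeBlindMerging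

end
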